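import Mathlib
import Literature.Analysis.FluidPDE.VectorCalculus
import Literature.Analysis.FluidPDE.ClassicalSolution
import Literature.Analysis.FluidPDE.LerayHopf
import Literature.Analysis.FluidPDE.LoopCirculation
import Summits.NavierStokesRegularity.NavierStokesRegularity.Theorems.TautLoopKelvinTautLoopLawSlabRegularity
import Summits.NavierStokesRegularity.NavierStokesRegularity.Theorems.TautLoopKelvinTautLoopLawStepSlabDeluxeTools
import Summits.NavierStokesRegularity.NavierStokesRegularity.Theorems.TautLoopKelvinTautLoopLawStepSliceAnalyticTools
import Summits.NavierStokesRegularity.NavierStokesRegularity.Theorems.TautLoopKelvinTautLoopLawStepIrrotationalRestTools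
import Summits.NavierStokesRegularity.NavierStokesRegularity.Theorems.TautLoopKelvinTautLoopLawStepVanishingOrderTools
import HarnessLib

/-!
# Route `TautLoopKelvin`, crux `TautLoopLaw` (stmt-NavierStokesRegularity-15249), line
  `Sketch-ideas-r1k1` (Dini–Saks architecture) — auxiliary tools stub `stub_tautLoopStepSelAux`
  serving the skeleton stub `stub_tautLoopStepOfSelection` (6B, the exact-level left-Dini step)

Auxiliary lemmas for the exact-level left-Dini step from the random-walk selection:

* `tautLoopStepSel_length_algebra` — the exponential length bookkeeping
  `(ℓ + h²)·e^{h(Λ + η/2)} + 5h² ≤ ℓ·e^{h(Λ + η)}` for `0 < h ≤ min(1, ℓη / (2(1 + 5e^{|Λ|})))`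
  (`e^{hη/2} ≥ 1 + hη/2` and `e^{-h(Λ + η/2)} ≤ e^{|Λ|}`);
* `tautLoopStepSel_lasso_threshold` — the lasso gain `w·min(w/L_c, h²)²/100` at vorticity
  `w = c·(h²)ᴺ` beats the circulation deficit `h^{6N+5}` once `h ≤ c·min(c/L_c, 1)²/100`;
* `tautLoopStepSel_curl_lipschitz` — a `C²` field with `‖D²v‖ ≤ B₂` has a
  `(‖curlCLM‖·B₂ + 1)`-Lipschitz curl (mean value inequality, `D(curl v) = curlCLM ∘ D²v`);
* `tautLoopStepSel_vanishing` — for a classical Leray–Hopf solution from a rapidly decaying datum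
  and `0 < t < T` with `u t ≢ 0`, the vorticity `curl (u s)` has uniform finite vanishing order on
  `[t/2, t] × B̄(0, R)` (joint smoothness of `curlCLM ∘ Du`, real-analyticity of positive-time
  slices `stub_tautLoopStepSliceAnalyticTools`, non-vanishing of every vorticity slice by the
  irrotational-rest alternative `stub_tautLoopStepIrrotationalRestTools`, and the pure-analysis
  statement `stub_tautLoopStepVanishingOrderTools`);
* `tautLoopStepSel_slab` — the slab package on `[t/2, t]`: sup bounds of `u`, `Du`, a uniform
  Lipschitz constant of the vorticity slices (`tautLoopSlabD_bounds` + the previous item), `C²`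
  slices, and the decay of `u t` at infinity in the form `‖x‖ ≥ R₀ ⇒ ‖u t x‖ ≤ κ₀`
  (`tautLoopSlab_tendsto_cocompact`).

Everything is folklore; the last theorem packages the statements as the registered auxiliary
tools stub.
-/

noncomputable section

open Set MeasureTheory Filter Topology Function Metric Literature.Analysis.FluidPDE
open scoped ENNReal NNReal

namespace Summit.NavierStokesRegularity.NavierStokesRegularity.Theorems

set_option linter.dupNamespace false

local notation3 "E3" => EuclideanSpace ℝ (Fin 3)

/-! ## Real-variable bookkeeping -/

/-- **Exponential length bookkeeping.** For `ℓ, η, h > 0`, `h ≤ 1` and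
`h ≤ ℓη / (2(1 + 5e^{|Λ|}))`:
`(ℓ + h²)·exp(h(Λ + η/2)) + 5h² ≤ ℓ·exp(h(Λ + η))`, since `exp(hη/2) ≥ 1 + hη/2` and
`exp(-h(Λ + η/2)) ≤ exp |Λ|`. [folklore] -/
theorem tautLoopStepSel_length_algebra (Er η Λr h : ℝ) (hEr : 0 < Er) (hη : 0 < η) (hh : 0 < h)
    (hh1 : h ≤ 1) (hhA : h ≤ Er * η / (2 * (1 + 5 * Real.exp |Λr|))) :
    (Er + h ^ 2) * Real.exp (h * (Λr + η / 2)) + 5 * h ^ 2 ≤ Er * Real.exp (h * (Λr + η)) := by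
  set A : ℝ := h * (Λr + η / 2) with hA_def
  have hsplit : Real.exp (h * (Λr + η)) = Real.exp A * Real.exp (h * η / 2) := by
    rw [← Real.exp_add, hA_def]
    congr 1
    ring
  have h1 : 1 + h * η / 2 ≤ Real.exp (h * η / 2) := by
    linarith [Real.add_one_le_exp (h * η / 2)]
  have heA : 0 < Real.exp A := Real.exp_pos A
  have hnegA : Real.exp (-A) ≤ Real.exp |Λr| := by
    refine Real.exp_le_exp.2 ?_
    have h2 : -(h * Λr) ≤ h * |Λr| := by
      rw [← mul_neg]
      exact mul_le_mul_of_nonneg_left (neg_le_abs Λr) hh.le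
    have h3 : h * |Λr| ≤ |Λr| := by nlinarith [abs_nonneg Λr]
    have h4 : -A = -(h * Λr) - h * η / 2 := by rw [hA_def]; ring
    nlinarith [mul_pos hh hη]
  have hkey : h * (1 + 5 * Real.exp |Λr|) ≤ Er * η / 2 := by
    have hpos : 0 < 2 * (1 + 5 * Real.exp |Λr|) := by positivity
    rw [le_div_iff₀ hpos] at hhA
    linarith
  have hinv : Real.exp (-A) * Real.exp A = 1 := by
    rw [← Real.exp_add, neg_add_cancel, Real.exp_zero]
  have hmain : h * Real.exp A + 5 * h ≤ Er * Real.exp A * η / 2 := by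
    have hfac : h * Real.exp A + 5 * h = h * Real.exp A * (1 + 5 * Real.exp (-A)) := by
      linear_combination (-5 * h) * hinv
    rw [hfac]
    calc h * Real.exp A * (1 + 5 * Real.exp (-A))
        ≤ h * Real.exp A * (1 + 5 * Real.exp |Λr|) := by gcongr
      _ = Real.exp A * (h * (1 + 5 * Real.exp |Λr|)) := by ring
      _ ≤ Real.exp A * (Er * η / 2) := by gcongr
      _ = Er * Real.exp A * η / 2 := by ring
  calc (Er + h ^ 2) * Real.exp A + 5 * h ^ 2
      = Er * Real.exp A + h * (h * Real.exp A + 5 * h) := by ring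
    _ ≤ Er * Real.exp A + h * (Er * Real.exp A * η / 2) := by gcongr
    _ = Er * Real.exp A * (1 + h * η / 2) := by ring
    _ ≤ Er * Real.exp A * Real.exp (h * η / 2) := by gcongr
    _ = Er * Real.exp (h * (Λr + η)) := by rw [hsplit, mul_assoc]

/-- **Lasso threshold.** With `w := c·(h²)ᴺ` and `0 < h ≤ min(1, c·min(c/L_c, 1)²/100)`, the
quantitative lasso gain `w·min(w/L_c, h²)²/100` dominates `h^{6N+5}`:
`min(w/L_c, h²) ≥ min(c/L_c, 1)·(h²)ᴺ·h²`, so the gain is `≥ (c·min(c/L_c,1)²/100)·h^{6N+4}`.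
[folklore] -/
theorem tautLoopStepSel_lasso_threshold (c Lc h : ℝ) (N : ℕ) (hc : 0 < c) (hLc : 0 < Lc)
    (hh : 0 < h) (hh1 : h ≤ 1) (hhG : h ≤ c * (min (c / Lc) 1) ^ 2 / 100) :
    h ^ (6 * N + 5) ≤ c * (h ^ 2) ^ N * (min (c * (h ^ 2) ^ N / Lc) (h ^ 2)) ^ 2 / 100 := by
  set c' : ℝ := min (c / Lc) 1 with hc'_def
  set P : ℝ := (h ^ 2) ^ N with hP_def
  set m : ℝ := min (c * P / Lc) (h ^ 2) with hm_def
  have hc'0 : 0 < c' := lt_min (div_pos hc hLc) one_pos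
  have hc'1 : c' ≤ 1 := min_le_right _ _
  have hh2 : 0 < h ^ 2 := by positivity
  have hh21 : h ^ 2 ≤ 1 := by nlinarith
  have hP0 : 0 < P := by positivity
  have hP1 : P ≤ 1 := pow_le_one₀ hh2.le hh21
  -- `m ≥ c' · P · h²`
  have hm : c' * P * h ^ 2 ≤ m := by
    refine le_min ?_ ?_
    · have h1 : c' * P * h ^ 2 ≤ c' * P := by
        have : 0 ≤ c' * P := by positivity
        nlinarith
      have h2 : c' * P ≤ c / Lc * P :=
        mul_le_mul_of_nonneg_right (min_le_left _ _) hP0.le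
      have h3 : c / Lc * P = c * P / Lc := by ring
      linarith
    · have : c' * P ≤ 1 := by nlinarith
      nlinarith
  have hm0 : 0 ≤ c' * P * h ^ 2 := by positivity
  have hm2 : (c' * P * h ^ 2) ^ 2 ≤ m ^ 2 := pow_le_pow_left₀ hm0 hm 2
  -- the powers of `h`
  have hpow4 : h ^ (6 * N + 4) = P ^ 3 * h ^ 4 := by
    rw [hP_def, ← pow_mul, ← pow_mul, ← pow_add]
    congr 1
    ring
  have hpow5 : h ^ (6 * N + 5) = h * (P ^ 3 * h ^ 4) := by
    rw [← hpow4, pow_succ, mul_comm]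
  rw [hpow5]
  calc h * (P ^ 3 * h ^ 4) ≤ c * c' ^ 2 / 100 * (P ^ 3 * h ^ 4) := by
        gcongr
    _ = c * P * (c' * P * h ^ 2) ^ 2 / 100 := by ring
    _ ≤ c * P * m ^ 2 / 100 := by gcongr

/-! ## Lipschitz vorticity from a Hessian bound -/

/-- **Lipschitz bound for the curl.** If `v : ℝ³ → ℝ³` is `C²` with `‖D²v‖ ≤ B₂`, then
`‖curl v x - curl v y‖ ≤ (‖curlCLM‖·B₂ + 1)·‖x - y‖` (mean value inequality for `curl v`, whose
derivative is `curlCLM ∘ D(Dv)`); the constant depends on `B₂` only. [folklore] -/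
theorem tautLoopStepSel_curl_lipschitz (B₂ : ℝ) (_hB₂ : 0 ≤ B₂) :
    ∃ Lc : ℝ, 0 < Lc ∧ ∀ v : E3 → E3, ContDiff ℝ 2 v → (∀ x, ‖iteratedFDeriv ℝ 2 v x‖ ≤ B₂) →
      ∀ x y, ‖curl v x - curl v y‖ ≤ Lc * ‖x - y‖ := by
  refine ⟨‖curlCLM‖ * B₂ + 1, by positivity, fun v hv hB x y => ?_⟩
  have hdiff : ∀ z ∈ (univ : Set E3), DifferentiableAt ℝ (curl v) z := fun z _ =>
    (contDiff_curl (n := 1) (by exact hv)).differentiable one_ne_zero z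
  have hbound : ∀ z ∈ (univ : Set E3), ‖fderiv ℝ (curl v) z‖ ≤ ‖curlCLM‖ * B₂ := fun z _ =>
    (norm_fderiv_curl_le hv z).trans (mul_le_mul_of_nonneg_left (hB z) (norm_nonneg curlCLM))
  have h := convex_univ.norm_image_sub_le_of_norm_fderiv_le hdiff hbound (mem_univ y) (mem_univ x)
  calc ‖curl v x - curl v y‖ ≤ ‖curlCLM‖ * B₂ * ‖x - y‖ := h
    _ ≤ (‖curlCLM‖ * B₂ + 1) * ‖x - y‖ := by nlinarith [norm_nonneg (x - y)]

/-! ## Uniform finite vanishing order of the vorticity on `[t/2, t]` -/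

/-- **Uniform finite vanishing order of the vorticity.** For a classical solution of the unforced
Navier–Stokes system on `[0, T) × ℝ³`, Leray–Hopf from its rapidly decaying datum, `0 < t < T`
with `u t ≢ 0`, and `R > 0`: there are `N`, `c > 0`, `d₀ > 0` such that for all `s ∈ [t/2, t]`,
`‖x‖ ≤ R`, `0 < d ≤ d₀` some `x'` with `‖x' - x‖ ≤ d` has `c·dᴺ ≤ ‖curl (u s) x'‖`. The vorticity
`(s, x) ↦ curl (u s) x = curlCLM (D(u s) x)` is jointly smooth on `[t/2, t] × ℝ³`; every slice is
real-analytic (`stub_tautLoopStepSliceAnalyticTools`) and not identically zero (else `u t ≡ 0` by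
`stub_tautLoopStepIrrotationalRestTools`); conclude by `stub_tautLoopStepVanishingOrderTools`.
[folklore] -/
theorem tautLoopStepSel_vanishing {ν T : ℝ} (hν : 0 < ν) (hT : 0 < T)
    {u : ℝ → E3 → E3} {p : ℝ → E3 → ℝ} (hcl : IsClassicalNSSolutionOn (Ico 0 T) ν 0 u p)
    (hLH : IsLerayHopfOn T ν 0 (u 0) u) (hdec : HasRapidSpatialDecay (u 0)) {t : ℝ} (ht : 0 < t)
    (htT : t < T) (hne : ∃ x, u t x ≠ 0) {R : ℝ} (hR : 0 < R) :
    ∃ N : ℕ, ∃ c : ℝ, 0 < c ∧ ∃ d₀ : ℝ, 0 < d₀ ∧ ∀ s ∈ Icc (t / 2) t, ∀ x : E3, ‖x‖ ≤ R →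
      ∀ d : ℝ, 0 < d → d ≤ d₀ → ∃ x' : E3, ‖x' - x‖ ≤ d ∧ c * d ^ N ≤ ‖curl (u s) x'‖ := by
  have ha : 0 < t / 2 := by positivity
  have hab : t / 2 < t := by linarith
  have hsub : Icc (t / 2) t ⊆ Ico 0 T := fun s hs => ⟨ha.le.trans hs.1, lt_of_le_of_lt hs.2 htT⟩
  have hcurl : (fun s x => curl (u s) x) = fun s x => curlCLM (fderiv ℝ (u s) x) := by
    funext s x
    exact curl_eq_curlCLM _ _
  have hsm : IsSmoothSpaceTimeOn (Icc (t / 2) t) (fun s x => curl (u s) x) := by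
    rw [hcurl]
    exact ((hcl.smooth_velocity.mono hsub).fderiv_slice (uniqueDiffOn_Icc hab)).clm_comp curlCLM
  have han : ∀ s ∈ Icc (t / 2) t, AnalyticOnNhd ℝ ((fun s x => curl (u s) x) s) univ :=
    fun s hs => (tautLoopAnal_slice_and_curl hν hT hcl hLH hdec (ha.trans_le hs.1)
      (lt_of_le_of_lt hs.2 htT)).2
  have hnz : ∀ s ∈ Icc (t / 2) t, ∃ x, (fun s x => curl (u s) x) s x ≠ 0 := by
    intro s hs
    by_contra h0
    push Not at h0
    obtain ⟨x, hx⟩ := hne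
    exact hx (stub_tautLoopStepIrrotationalRestTools ν T hν hT u p hcl hLH hdec s t
      (ha.le.trans hs.1) hs.2 htT h0 x)
  exact stub_tautLoopStepVanishingOrderTools _ (t / 2) t R hab.le hR hsm han hnz

/-! ## The slab package on `[t/2, t]` -/

/-- **Slab package on `[t/2, t]`.** For a classical solution of the unforced Navier–Stokes system
on `[0, T) × ℝ³`, Leray–Hopf from its rapidly decaying datum, and `0 < t < T`: sup bounds
`‖u s x‖ ≤ B₀` (`B₀ > 0`) on `[t/2, t]`, `‖D(u t)‖ ≤ B₁`, `C²` slices, a uniform Lipschitz constant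
`L_c > 0` of the vorticity slices `curl (u s)`, `s ∈ [t/2, t]` (`tautLoopSlabD_bounds` with
`n = 0, 1, 2` and `tautLoopStepSel_curl_lipschitz`), and the decay of `u t` at infinity:
`‖u t x‖ ≤ κ₀` for `‖x‖ ≥ R₀(κ₀)` (`tautLoopSlab_tendsto_cocompact`). [folklore] -/
theorem tautLoopStepSel_slab {ν T : ℝ} (hν : 0 < ν) (hT : 0 < T)
    {u : ℝ → E3 → E3} {p : ℝ → E3 → ℝ} (hcl : IsClassicalNSSolutionOn (Ico 0 T) ν 0 u p)
    (hLH : IsLerayHopfOn T ν 0 (u 0) u) (hdec : HasRapidSpatialDecay (u 0)) {t : ℝ} (ht : 0 < t)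
    (htT : t < T) :
    ∃ B₀ B₁ Lc : ℝ, 0 < B₀ ∧ 0 ≤ B₁ ∧ 0 < Lc ∧
      (∀ s ∈ Icc (t / 2) t, ∀ x, ‖u s x‖ ≤ B₀) ∧ (∀ x, ‖fderiv ℝ (u t) x‖ ≤ B₁) ∧
      (∀ s ∈ Icc (t / 2) t, ContDiff ℝ 2 (u s)) ∧
      (∀ s ∈ Icc (t / 2) t, ∀ x y : E3, ‖curl (u s) x - curl (u s) y‖ ≤ Lc * ‖x - y‖) ∧
      (∀ κ₀ : ℝ, 0 < κ₀ → ∃ R₀ : ℝ, ∀ x : E3, R₀ ≤ ‖x‖ → ‖u t x‖ ≤ κ₀) := by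
  have ha : 0 < t / 2 := by positivity
  have hab : t / 2 < t := by linarith
  have htI : t ∈ Icc (t / 2) t := ⟨hab.le, le_rfl⟩
  obtain ⟨hB, -⟩ := tautLoopSlabD_bounds hν hT hcl hLH hdec ha hab htT
  obtain ⟨B₀, -, h0⟩ := hB 0
  obtain ⟨B₁, hB₁, h1⟩ := hB 1
  obtain ⟨B₂, hB₂, h2⟩ := hB 2
  have hsub : Icc (t / 2) t ⊆ Ico 0 T := fun s hs => ⟨ha.le.trans hs.1, lt_of_le_of_lt hs.2 htT⟩
  have hC2 : ∀ s ∈ Icc (t / 2) t, ContDiff ℝ 2 (u s) := fun s hs =>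
    (hcl.contDiff_velocity (hsub hs)).of_le (by norm_cast)
  obtain ⟨Lc, hLc, hLip⟩ := tautLoopStepSel_curl_lipschitz B₂ hB₂
  refine ⟨B₀ + 1, B₁, Lc, by linarith [(norm_nonneg _).trans (h0 t htI 0)], hB₁, hLc,
    fun s hs x => ?_, fun x => ?_, hC2, fun s hs x y => hLip (u s) (hC2 s hs) (h2 s hs) x y,
    fun κ₀ hκ₀ => ?_⟩
  · have h := h0 s hs x
    rw [norm_iteratedFDeriv_zero] at h
    linarith
  · have h := h1 t htI x
    rwa [norm_iteratedFDeriv_one] at h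
  · have hlim := tautLoopSlab_tendsto_cocompact hν hcl hLH hdec (t := t) ⟨ht.le, htT⟩
    rw [← Metric.cobounded_eq_cocompact] at hlim
    obtain ⟨r, -, hr⟩ := (Metric.hasBasis_cobounded_compl_closedBall (0 : E3)).tendsto_left_iff.1
      hlim (closedBall 0 κ₀) (closedBall_mem_nhds 0 hκ₀)
    refine ⟨r + 1, fun x hx => ?_⟩
    have hx' : x ∈ (closedBall (0 : E3) r)ᶜ := by
      rw [mem_compl_iff, mem_closedBall, dist_zero_right, not_le]
      linarith
    have h := hr hx'
    rwa [mem_closedBall, dist_zero_right] at h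

/-! ## The registered auxiliary tools stub -/

/-- **Auxiliary tools stub `stub_tautLoopStepSelAux`** (registered; serves the skeleton stub
`stub_tautLoopStepOfSelection`): the conjunction of the exponential length bookkeeping, the lasso
threshold, the Lipschitz bound for the curl under a Hessian bound, the uniform finite vanishing
order of the vorticity of the Clay class on `[t/2, t] × B̄(0, R)` when `u t ≢ 0`, and the slab
package on `[t/2, t]`, with all binders explicit. [folklore] -/
theorem stub_tautLoopStepSelAux :
    (∀ (Er η Λr h : ℝ), 0 < Er → 0 < η → 0 < h → h ≤ 1 → h ≤ Er * η / (2 * (1 + 5 * Real.exp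
    |Λr|)) → (Er + h ^ 2) * Real.exp (h * (Λr + η / 2)) + 5 * h ^ 2 ≤ Er * Real.exp (h * (Λr +
    η))) ∧ (∀ (c Lc h : ℝ) (N : ℕ), 0 < c → 0 < Lc → 0 < h → h ≤ 1 → h ≤ c * (min (c / Lc) 1) ^ 2
    / 100 → h ^ (6 * N + 5) ≤ c * (h ^ 2) ^ N * (min (c * (h ^ 2) ^ N / Lc) (h ^ 2)) ^ 2 / 100) ∧
    (∀ B₂ : ℝ, 0 ≤ B₂ → ∃ Lc : ℝ, 0 < Lc ∧ ∀ v : EuclideanSpace ℝ (Fin 3) → EuclideanSpace ℝ (Fin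
    3), ContDiff ℝ 2 v → (∀ x, ‖iteratedFDeriv ℝ 2 v x‖ ≤ B₂) → ∀ x y : EuclideanSpace ℝ (Fin 3),
    ‖Literature.Analysis.FluidPDE.curl v x - Literature.Analysis.FluidPDE.curl v y‖ ≤ Lc * ‖x -
    y‖) ∧ (∀ (ν T : ℝ), 0 < ν → 0 < T → ∀ (u : ℝ → EuclideanSpace ℝ (Fin 3) → EuclideanSpace ℝ
    (Fin 3)) (p : ℝ → EuclideanSpace ℝ (Fin 3) → ℝ),
    Literature.Analysis.FluidPDE.IsClassicalNSSolutionOn (Set.Ico 0 T) ν 0 u p →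
    Literature.Analysis.FluidPDE.IsLerayHopfOn T ν 0 (u 0) u →
    Literature.Analysis.FluidPDE.HasRapidSpatialDecay (u 0) → ∀ t : ℝ, 0 < t → t < T → (∃ x, u t x
    ≠ 0) → ∀ R : ℝ, 0 < R → ∃ N : ℕ, ∃ c : ℝ, 0 < c ∧ ∃ d₀ : ℝ, 0 < d₀ ∧ ∀ s ∈ Set.Icc (t / 2) t,
    ∀ x : EuclideanSpace ℝ (Fin 3), ‖x‖ ≤ R → ∀ d : ℝ, 0 < d → d ≤ d₀ → ∃ x' : EuclideanSpace ℝ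
    (Fin 3), ‖x' - x‖ ≤ d ∧ c * d ^ N ≤ ‖Literature.Analysis.FluidPDE.curl (u s) x'‖) ∧ (∀ (ν T :
    ℝ), 0 < ν → 0 < T → ∀ (u : ℝ → EuclideanSpace ℝ (Fin 3) → EuclideanSpace ℝ (Fin 3)) (p : ℝ →
    EuclideanSpace ℝ (Fin 3) → ℝ), Literature.Analysis.FluidPDE.IsClassicalNSSolutionOn (Set.Ico 0
    T) ν 0 u p → Literature.Analysis.FluidPDE.IsLerayHopfOn T ν 0 (u 0) u →
    Literature.Analysis.FluidPDE.HasRapidSpatialDecay (u 0) → ∀ t : ℝ, 0 < t → t < T → ∃ B₀ B₁ Lc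
    : ℝ, 0 < B₀ ∧ 0 ≤ B₁ ∧ 0 < Lc ∧ (∀ s ∈ Set.Icc (t / 2) t, ∀ x, ‖u s x‖ ≤ B₀) ∧ (∀ x, ‖fderiv ℝ
    (u t) x‖ ≤ B₁) ∧ (∀ s ∈ Set.Icc (t / 2) t, ContDiff ℝ 2 (u s)) ∧ (∀ s ∈ Set.Icc (t / 2) t, ∀ x
    y : EuclideanSpace ℝ (Fin 3), ‖Literature.Analysis.FluidPDE.curl (u s) x -
    Literature.Analysis.FluidPDE.curl (u s) y‖ ≤ Lc * ‖x - y‖) ∧ (∀ κ₀ : ℝ, 0 < κ₀ → ∃ R₀ : ℝ, ∀ x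
    : EuclideanSpace ℝ (Fin 3), R₀ ≤ ‖x‖ → ‖u t x‖ ≤ κ₀)) :=
  ⟨tautLoopStepSel_length_algebra, tautLoopStepSel_lasso_threshold,
    tautLoopStepSel_curl_lipschitz,
    fun _ν _T hν hT _u _p hcl hLH hdec _t ht htT hne _R hR =>
      tautLoopStepSel_vanishing hν hT hcl hLH hdec ht htT hne hR,
    fun _ν _T hν hT _u _p hcl hLH hdec _t ht htT => tautLoopStepSel_slab hν hT hcl hLH hdec ht htT⟩

end Summit.NavierStokesRegularity.NavierStokesRegularity.Theorems

end
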